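import Summits.ValiantsHypothesis.ValiantsHypothesis.Theorems.GeneratorObstructionsPerGenDegreeSuperQPTrivialSupport
import Literature.Computability.Complexity.OccurrenceObstructionsIPExceptional

/-!
# Route GeneratorObstructions — K1 `PerGenDegreeSuperQP` (stmt-ValiantsHypothesis-11654),
# line `per-side-atoms`: HOLES of the occurrence monoid — Ikenmeyer–Panova's exceptional
# classes (in particular the hooks `(md-1, 1)`, one in every degree `d`) never occur in
# `ℂ[Δ_m[per_m]]`

Companion of `…Sandwich` / `…TrivialSupport`. The earlier support files of the line are
OCCUPANCY results (rays and faces of `S(per_m)` that are hit); the sandwich format asks instead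
for the HOLES of `S(per_m)` inside its natural over-monoids. This file certifies the cheapest
infinite family of holes — those cut out by the AMBIENT test (plethysm):

* `not_occurs_of_plethysmCoeff_eq_zero` — for any form `f` of degree `n ≠ 0` (any linearly
  ordered variables): if the plethysm coefficient of `χ` in `ℂ[Sym^n]` vanishes then `χ` does
  not occur in `ℂ[Δ_n[f]]` (contrapositive of the lift `hasHighestWeight_coordRep_of_orbitCoordRep_holds`;
  highest-weight spaces of `ℂ[Sym^n]` are finite-dimensional, `finiteDimensional_highestWeightSpace_coordRep_holds`).
* `per_not_occurs_of_body_mem_ipExceptionalBodies` — for `1 ≤ m` and every `d`, a partition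
  `λ ⊢ m·d` with at most `m²` parts whose BODY `λ̄` (the parts below the first) lies in
  Ikenmeyer–Panova's exceptional set `𝔛 = {(1), (1,1), (1⁴), (1⁶), (2,1), (3,1)}` gives a weight
  `λ^*` that does NOT occur in `ℂ[Δ_m[per_m]]`: the tree's discharged IP Thm. 1.7(a)
  (`ikenmeyerPanova2017_thm_1_7a_holds`: `a_λ(d[m]) = 0`, proved there directly by the hook
  cancellation of `PlethysmHookVanishing.lean`).
* `per_not_occurs_hook` — in particular the HOOKS `λ_d = (md - 1, 1)` (`md ≥ 2`): for every
  degree `d` the weight `λ_d^*` is a hole of `S(per_m)`.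

Why this matters for the line (informal; NOT used in the proofs). On paper the hooks `λ_d`,
`d ≥ 3`, ARE orbit types of `per_m` for `m ≥ 3` (`V_{(n-1,1)} = ker(S^{n-1}W ⊗ W → S^nW)` has
weight space at a "magic" exponent matrix `μ` equal to the zero-sum functions on `supp μ`, and a
`μ` with line sums `d` and two distinct nonzero entries carries a `Stab_{H_per}(μ)`-invariant
such function). So `S(per_m)` has holes inside the nonpositive lift of the orbit monoid
`{λ : V_λ^{H_per} ≠ 0}` in EVERY degree, and the sandwich of `…Sandwich` cannot be run on the
orbit monoid alone — the reason `…TrivialSupport` intersects it with the plethysm support. The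
orbit-type half (`IK2020.weylInvariantDim ℂ (m·m) λ_d (stab per_m) ≠ 0`) is not proved here.

Honest framing: non-occurrence bookkeeping from discharged plethysm vanishing; `stub_atomLate`
(for `c ≥ 2`), K1 and `GenFlipThesis` remain OPEN; nothing here bears on VP versus VNP.
References: [IkenmeyerPanova2017] Thm. 1.7(a); [BurgisserIkenmeyerPanovaJAMS2019] Prop. 3.3,
Lemma 4.3; [BurgisserEtAl2011] §4.4. [folklore]
-/

set_option linter.dupNamespace false

namespace Summit.ValiantsHypothesis.ValiantsHypothesis.Theorems.GeneratorObstructions.PerGenDegreeSuperQP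

open MvPolynomial
open Literature.NumberTheory.DiophantineGeometry Literature.Computability.AlgebraicComplexity
  Literature.Computability.Complexity

/-! ### 1. Plethysm zeros are holes of every occurrence monoid -/

section General

variable {σ : Type*} [Fintype σ] [LinearOrder σ]

/-- **Plethysm zeros never occur.** For a form `f` of degree `n ≠ 0` and a weight `χ` whose
plethysm coefficient in `ℂ[Sym^n ℂ^σ]` vanishes (`plethysmCoeff ℂ σ n χ = 0`), `χ` does not occur
in `ℂ[Δ_n[f]]`: an occurring weight lifts to a nonzero highest-weight vector of `ℂ[Sym^n]`
(`hasHighestWeight_coordRep_of_orbitCoordRep_holds`), whose (finite-dimensional) highest-weight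
space would then have positive dimension. BLMW 2011 §4.4. [cite: BurgisserEtAl2011, §4.4] -/
theorem not_occurs_of_plethysmCoeff_eq_zero (f : MvPolynomial σ ℂ) {n : ℕ} (hn : n ≠ 0)
    (hf : f.IsHomogeneous n) {χ : Weight σ} (h0 : plethysmCoeff ℂ σ n χ = 0) :
    highestWeightSpace (orbitCoordRep f n) χ = ⊥ := by
  haveI : Infinite ℂ := CharZero.infinite ℂ
  by_contra hne
  have hamb : HasHighestWeight (coordRep σ ℂ n) χ :=
    hasHighestWeight_coordRep_of_orbitCoordRep_holds f hn hf
      (show HasHighestWeight (orbitCoordRep f n) χ from hne)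
  haveI : FiniteDimensional ℂ ↥(highestWeightSpace (coordRep σ ℂ n) χ) :=
    finiteDimensional_highestWeightSpace_coordRep_holds hn χ
  have hfin : Module.finrank ℂ ↥(highestWeightSpace (coordRep σ ℂ n) χ) = 0 := h0
  exact hamb (Submodule.finrank_eq_zero.mp hfin)

end General

/-! ### 2. The permanent: Ikenmeyer–Panova's exceptional classes and the hooks `(md-1, 1)` -/

section Permanent

variable {m : ℕ}

/-- **IP's exceptional classes are holes of `S(per_m)`.** For `1 ≤ m`, every `d`, and every
partition `λ ⊢ m·d` with at most `m²` parts whose body lies in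
`𝔛 = {(1), (1,1), (1⁴), (1⁶), (2,1), (3,1)}`, the weight `λ^*` (`partitionWeightLex m λ`, i.e.
`(Weight.dualOfPartition (m·m) λ).toMatIdx`) does NOT occur in `ℂ[Δ_m[per_m]]`: its plethysm
coefficient vanishes (tree `ikenmeyerPanova2017_thm_1_7a_holds`, IP Thm. 1.7(a)).
[cite: IkenmeyerPanova2017, Thm. 1.7(a)] -/
theorem per_not_occurs_of_body_mem_ipExceptionalBodies (hm : 1 ≤ m) {d : ℕ}
    (lam : Nat.Partition (m * d)) (hlam : lam.parts.card ≤ m * m)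
    (hX : body lam ∈ ipExceptionalBodies) :
    highestWeightSpace (orbitCoordRep (MvPolynomial.rename toLex (perPoly (Fin m) ℂ)) m)
      (partitionWeightLex m lam) = ⊥ := by
  haveI : NeZero m := ⟨by omega⟩
  exact not_occurs_of_plethysmCoeff_eq_zero _ (by omega) (perFormLex_isHomogeneous m)
    (ikenmeyerPanova2017_thm_1_7a_holds m d lam hlam hX)

/-- The body of the hook `(md - 1, 1)` is `(1)`. [folklore] -/
theorem body_eq_singleton_one_of_parts_eq {N : ℕ} (lam : Nat.Partition N) {a : ℕ} (ha : 1 ≤ a)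
    (hparts : lam.parts = {a, 1}) : body lam = {1} := by
  rw [body_def, hparts]
  have hsup : ({a, 1} : Multiset ℕ).sup = a := by
    rw [Multiset.insert_eq_cons, Multiset.sup_cons, Multiset.sup_singleton]
    exact sup_eq_left.mpr ha
  rw [hsup, Multiset.insert_eq_cons, Multiset.erase_cons_head]

/-- **The hooks `(md-1, 1)` are holes of `S(per_m)`, one in every degree.** For `1 ≤ m` and
`2 ≤ m·d`, the partition `λ_d ⊢ m·d` with parts `{md - 1, 1}` (two parts, so at most `m²` of them
as soon as `m ≥ 2`; for `m = 1` the hypothesis `λ.parts.card ≤ m·m` is kept explicit) gives a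
weight `λ_d^*` at which `ℂ[Δ_m[per_m]]` has NO highest-weight vector (the plethysm
`Sym^d Sym^m` contains no `(md-1,1)`: `dim Sym^dSym^m[(md-1,1)] = dim Sym^dSym^m[(md)] = 1`; here
via IP Thm. 1.7(a), body `(1) ∈ 𝔛`). On paper these are orbit types of `per_m` for `m, d ≥ 3`
(module docstring), i.e. holes of the closure monoid inside the orbit monoid in every degree.
[cite: IkenmeyerPanova2017, Thm. 1.7(a)] -/
theorem per_not_occurs_hook (hm : 1 ≤ m) {d : ℕ} (hd : 2 ≤ m * d)
    (lam : Nat.Partition (m * d)) (hparts : lam.parts = {m * d - 1, 1})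
    (hlam : lam.parts.card ≤ m * m) :
    highestWeightSpace (orbitCoordRep (MvPolynomial.rename toLex (perPoly (Fin m) ℂ)) m)
      (partitionWeightLex m lam) = ⊥ :=
  per_not_occurs_of_body_mem_ipExceptionalBodies hm lam hlam (by
    rw [body_eq_singleton_one_of_parts_eq lam (show 1 ≤ m * d - 1 by omega) hparts,
      mem_ipExceptionalBodies_iff]
    exact Or.inl rfl)

/-- **Existence form**: for `2 ≤ m` and every `d ≥ 1` there IS a partition `λ ⊢ m·d` with at
most `m²` parts (namely `(md-1, 1)`) whose dual weight is a hole of `S(per_m)` — the occurrence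
monoid of the permanent misses, in every degree, a weight that is a plethysm zero (and, on paper,
an orbit type of `per_m` for `m, d ≥ 3`). [folklore] -/
theorem per_exists_hole_every_degree (hm : 2 ≤ m) {d : ℕ} (hd : 1 ≤ d) :
    ∃ lam : Nat.Partition (m * d), lam.parts.card ≤ m * m ∧ lam.parts = {m * d - 1, 1} ∧
      highestWeightSpace (orbitCoordRep (MvPolynomial.rename toLex (perPoly (Fin m) ℂ)) m)
        (partitionWeightLex m lam) = ⊥ := by
  have hmd : 2 ≤ m * d := le_trans (by omega) (Nat.mul_le_mul hm hd)
  let lam : Nat.Partition (m * d) :=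
    { parts := {m * d - 1, 1}
      parts_pos := by
        intro i hi
        rw [Multiset.insert_eq_cons, Multiset.mem_cons, Multiset.mem_singleton] at hi
        omega
      parts_sum := by
        rw [Multiset.insert_eq_cons, Multiset.sum_cons, Multiset.sum_singleton]
        omega }
  have hcard : lam.parts.card ≤ m * m := by
    show Multiset.card ({m * d - 1, 1} : Multiset ℕ) ≤ m * m
    rw [Multiset.insert_eq_cons, Multiset.card_cons, Multiset.card_singleton]
    nlinarith
  exact ⟨lam, hcard, rfl, per_not_occurs_hook (by omega) hmd lam rfl hcard⟩

end Permanent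

end Summit.ValiantsHypothesis.ValiantsHypothesis.Theorems.GeneratorObstructions.PerGenDegreeSuperQP
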